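import Summits.HodgeConjecture.HodgeConjecture.Theorems.F0P2cOmegaLocalType
import Literature.NumberTheory.Rogawski1990.CohomologicalFinComponentIsTheta
import Literature.RepresentationTheory.Liu2021.GlobalOscillatorIsomorphismCriterion
import Literature.NumberTheory.GelbartRogawski1991.FiniteAdelicWeilCentralCoinvariantsIsotypic
import HarnessLib

/-!
# Crux `H413`, (C) desk — THE ENGINE LETTER CE OF `F0_P2CohFinComponentIsThetaC` REDUCED TO ITS AUTOMORPHIC CORE: «the local components of a
# cotangent-type finite component ARE Liu's local theta types» ⇒ CE (registered body, BY NAME up to `IsLocalTypeAt` unfolding)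

Cell hodgecm-mathlib (D-0151), FLOOR 0, crux item H413 = stmt-HodgeConjecture-24833; programme P2; (C)-desk sub-line `Cruxes/H413/Lines/F0_P2CohFinComponentIsThetaC.lean`
(F0P2-plan (g3); stubs CE ∕ CL ★ ∕ CF ∕ CI ★).  Author F0P2-p01 (g3).  THEOREMS ONLY (no `def`, no instance, no named fact, no `sorry`);
`--supports stmt-HodgeConjecture-24833 --as helper`; never imports a `Cruxes/…/Lines` module (s380b): the registered CE body (tree v1.1 :210) is RESTATED
VERBATIM with `IsLocalTypeAt` unfolded (s347) as the conclusion.  HC_CM is proved only modulo the printed citations until rung 0 closes; this file proves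
no printed citation — it splits the engine letter CE into (engine core CE_R) ∘ (★ theta side):

* **CE_R** (the hypothesis `hR`): the (C♭) telescope of CE verbatim, conclusion «∃ `μ` conjugate-symplectic of weight one, `a ∈ (L⁺)ˣ`, `χ` such that at
  EVERY finite `v` the `ℂ[U(H)(L⁺_v)]`-module of `σ ∘ inclPlace v` is `X_v(μ, a, χ) ∘ κ_v⁻¹`-isotypic» — `X_v` Liu's local theta type on `U(diag dV)(L⁺_v)`
  (the type of ★ `Def411WeilCarriers.isotypicComponent_rhoAtLine_comp_eq_top_of_lemD1AsPrinted` at the (C)-line frame data), `κ_v⁻¹ : U(H)(L⁺_v) ≃ U(diag dV)(L⁺_v)`,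
  `u ↦ g_v⁻¹ u g_v`, the frame congruence (★ `UnitaryGroup.localCongr`).  This is Rogawski's classification of the cohomological spectrum of `U(2,1)` +
  the GR91∕HKS96 packet dictionary + the Hasse principle for the line `⟨a⟩`, with NO `rhoAtLine`, NO restricted tensor product and NO frame transport left
  in it: a statement about `σ` and LOCAL objects only. [Rogawski1990 Thm 13.3.6 (c), §12.3, §13.3; Rogawski1992 Thm 1.1; GelbartRogawski1991 Lem 5.1.2;
  HarrisKudlaSweet1996 Thm 6.1]
* **`stubCE_of_localThetaTypes (hR) : ‹registered CE body›`** — over ★ `F0P2cOmegaLocalType.isLocalTypeAt_rhoAtLine_chi` (CE-L: `ω_H ∘ inclPlace v` is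
  `X_v ∘ κ_v⁻¹`-isotypic and `X_v ∘ κ_v⁻¹` is irreducible — UNCONDITIONAL), uniqueness of local types (★ `Liu2021.nonempty_equiv_of_isotypicComponent_eq_top`:
  two irreducible types of the non-zero `σ ∘ inclPlace v` are equivalent; `σ ≠ 0` since irreducible) and type-independence of isotypy
  (★ `isotypicComponent_asModule_congr_type`).  Conversely CE ⇒ CE_R over CL ★ (`stubCL_holds`: the admissible `σ` HAS a local type) and the same two ★
  facts applied to `ω_H` (irreducible by CI ★) — not restated here; so the registered letter and CE_R are EQUIVALENT over the tree.

## References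
* [Rogawski1990] J. Rogawski, Ann. of Math. Stud. 123 (1990): Thm 13.3.6 (c), §12.3, §13.3, §14.6.  [Rogawski1992] Thm 1.1.
* [GelbartRogawski1991] S. Gelbart, J. Rogawski, Invent. Math. 105 (1991): Thm 5.1.1, Lem 5.1.2, §3.1 Prop 3.1.1.  [HarrisKudlaSweet1996] J. AMS 9 (1996): Thm 6.1.
* [Liu2021] Y. Liu, Camb. J. Math. 9 (2021) = arXiv:2102.11518: Def 4.11, Rem 4.14, App. D Lem D.1 (1)(3), Thm 4.18 (2) (l. 2270).
* [Flath1979] D. Flath, PSPM 33.1 (1979): Thm 3 (uniqueness clause).  [Bump1997] §3.4 Prop 3.4.1.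
-/

set_option autoImplicit false

-- the mandated namespace has the single-problem summit's repeated segment (`HodgeConjecture.HodgeConjecture`)
set_option linter.dupNamespace false

noncomputable section

namespace Summit.HodgeConjecture.HodgeConjecture.Cruxes.H413.F0P2cStubCEOfLocalThetaTypes

open NumberField MeasureTheory IsDedekindDomain
open scoped Matrix ComplexOrder
open Literature.NumberTheory Literature.NumberTheory.Automorphic Literature.NumberTheory.Automorphic.UnitaryGroup
open Literature.NumberTheory.Automorphic.UnitaryGroup.CotangentForms
open Literature.NumberTheory.Automorphic.IdeleClassGroup
open Literature.NumberTheory.Automorphic.Liu2021 Literature.NumberTheory.Automorphic.Liu2021.Def411WeilCarriers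
open Literature.NumberTheory.Automorphic.Liu2021.Def411WeilCarriersDoubling
open Literature.NumberTheory.GelbartRogawski1991 Literature.NumberTheory.GelbartRogawski1991.UnitaryDualPair
open Literature.NumberTheory.GelbartRogawski1991.UnitaryDualPair.WeilCoinv
open Literature.RepresentationTheory Literature.RepresentationTheory.Liu2021
open Literature.NumberTheory.Rogawski1990
open Summit.HodgeConjecture.CorCM.Transposition

set_option synthInstance.maxHeartbeats 400000 in
set_option maxHeartbeats 8000000 in
/-- **CE from its automorphic core CE_R** — «at every finite place the local component of `σ` is Liu's local theta type `X_v(μ, a, χ)` read on `U(H)(L⁺_v)`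
through the frame congruence» implies the registered engine letter CE of the (C)-line (body VERBATIM, `IsLocalTypeAt` unfolded): given an irreducible `τ`
with `σ ∘ inclPlace v` `τ`-isotypic, `τ ≃ X_v ∘ κ_v⁻¹` (two irreducible types of the non-zero module `σ|_v`: ★ `Liu2021.nonempty_equiv_of_isotypicComponent_eq_top`),
and `ω_H ∘ inclPlace v` is `X_v ∘ κ_v⁻¹`-isotypic UNCONDITIONALLY (★ `F0P2cOmegaLocalType.isLocalTypeAt_rhoAtLine_chi`), hence `τ`-isotypic
(★ `isotypicComponent_asModule_congr_type`). [cite: Rogawski1990, Thm 13.3.6 (c), §13.3] [cite: GelbartRogawski1991, Lem 5.1.2] [cite: Liu2021, Def 4.11, App. D Lem D.1 (1), Thm 4.18 (2)]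
[cite: Flath1979, Thm 3] -/
theorem stubCE_of_localThetaTypes
    (hR :
      ∀ (L : Type) [Field L] [NumberField L] [IsCMField L] (ι : L →+* ℂ) (H : Matrix (Fin 3) (Fin 3) L) (T : GL (Fin 3) ℂ)
        (hT : (T : Matrix (Fin 3) (Fin 3) ℂ)ᴴ * H.map ι * (T : Matrix (Fin 3) (Fin 3) ℂ) = Literature.Geometry.ComplexHyperbolic.BallModel.J),
        (∀ τ' : L →+* ℂ, InfinitePlace.mk τ' ≠ InfinitePlace.mk ι → (H.map τ').PosDef) → 2 ≤ Module.finrank ℚ ↥(maximalRealSubfield L) →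
        ∀ {n' : ℕ} (e₁ : Fin 3 × Fin 1 ≃ Fin n') (dV : Fin 3 → L) (hdV : ∀ i, IsCMField.complexConj L (dV i) = dV i)
          (hdV0 : ∀ i, dV i ≠ 0) (g : GL (Fin 3) L)
          (hg : ((g : Matrix (Fin 3) (Fin 3) L).map (cmConjRingHom L))ᵀ * H * (g : Matrix (Fin 3) (Fin 3) L) = Matrix.diagonal dV)
          (ιV : finAdelic (↥(maximalRealSubfield L)) L (IsCMField.complexConj L) 3 H →*
              finAdelic (↥(maximalRealSubfield L)) L (IsCMField.complexConj L) 3 (Matrix.diagonal dV)),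
            (∀ k, ((ιV k : finAdelic (↥(maximalRealSubfield L)) L (IsCMField.complexConj L) 3 (Matrix.diagonal dV)) :
                GL (Fin 3) (FiniteAdeleRing (𝓞 L) L)) =
              (toFinAdeleGL L 3 g)⁻¹ * (k : GL (Fin 3) (FiniteAdeleRing (𝓞 L) L)) * toFinAdeleGL L 3 g) →
            ∀ (μ : Measure (adelicGroupData (↥(maximalRealSubfield L)) L (IsCMField.complexConj L) 3 H).automorphicQuotient)
              [(adelicGroupData (↥(maximalRealSubfield L)) L (IsCMField.complexConj L) 3 H).IsAutomorphicMeasure μ]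
              (W : Type) [AddCommGroup W] [Module ℂ W]
              (σ : Representation ℂ (finAdelic (↥(maximalRealSubfield L)) L (IsCMField.complexConj L) 3 H) W),
              σ.IsIrreducible → σ.IsSmooth → σ.IsAdmissible →
              ∀ P : DiscreteAutomorphicRep (adelicGroupData (↥(maximalRealSubfield L)) L (IsCMField.complexConj L) 3 H) μ,
                (P.IsHolCotangentAt (cmArchSection L ι H T hT) (cmCompactFactor L ι H T hT) ∨
                  P.IsAntiholCotangentAt (cmArchSection L ι H T hT) (cmCompactFactor L ι H T hT)) →
                P.HasFinComponent σ →
                ∃ (μ : Literature.NumberTheory.Automorphic.IdeleClassGroup L →ₜ* Circle) (hμ : IsConjugateSymplectic L μ), HasWeight L μ 1 ∧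
                  ∃ (a : (↥(maximalRealSubfield L))ˣ) (χ : Chi (↥(maximalRealSubfield L)) L (IsCMField.complexConj L)),
                    ∀ (v : HeightOneSpectrum (𝓞 ↥(maximalRealSubfield L))),
                      isotypicComponent (MonoidAlgebra ℂ (localPi L (IsCMField.complexConj L) 3 H v))
                        (Representation.asModule (σ.comp (inclPlace (↥(maximalRealSubfield L)) L (IsCMField.complexConj L) 3 H v)))
                        (Representation.asModule
                          (((show Representation ℂ (localPi L (IsCMField.complexConj L) 3 (Matrix.diagonal dV) v) _ from
                          (TwistedCoinv.rep (localCharOfCenter (↥(maximalRealSubfield L)) L (IsCMField.complexConj L)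
                              (JW (↥(maximalRealSubfield L)) L a) (JW_apply_ne_zero (↥(maximalRealSubfield L)) L a) χ.1 v)
                            ((OmegaChiSplitting.chiLocalSplittingsD ⟨L⟩ e₁ dV hdV hdV0 (toHeckeCharacter L μ)
                              ((isOscillatorChar_toHeckeCharacter_iff μ).mpr hμ) a).omegaLoc v)
                            (commute_omegaLoc_localCenter (↥(maximalRealSubfield L)) L (IsCMField.complexConj L) 3 e₁ (Matrix.diagonal dV)
                              (JW (↥(maximalRealSubfield L)) L a) (complexConj_imagUnit L) (imagUnit_ne_zero L) (imagUnit_mul_self L)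
                              (realDiagonal_isSymm L dV hdV) (isSymm_TW (↥(maximalRealSubfield L)) a) (realDiagonal_map L dV hdV).symm
                              (JW_eq (↥(maximalRealSubfield L)) L a) (JW_apply_ne_zero (↥(maximalRealSubfield L)) L a)
                              (OmegaChiSplitting.chiLocalSplittingsD ⟨L⟩ e₁ dV hdV hdV0 (toHeckeCharacter L μ)
                                ((isOscillatorChar_toHeckeCharacter_iff μ).mpr hμ) a) v)).comp
                            (UnitaryGroup.localLineInl L (IsCMField.complexConj L) 3 e₁ (Matrix.diagonal dV) (JW (↥(maximalRealSubfield L)) L a) v)) :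
                            localPi L (IsCMField.complexConj L) 3 (Matrix.diagonal dV) v →* _).comp
                          (localCongr L (IsCMField.complexConj L) g one_ne_zero
                            (F0P2cOmegaLocalType.formCongr_frame L H dV g hg) v).symm.toMulEquiv.toMonoidHom)) = ⊤) :
      ∀ (L : Type) [Field L] [NumberField L] [IsCMField L] (ι : L →+* ℂ) (H : Matrix (Fin 3) (Fin 3) L) (T : GL (Fin 3) ℂ)
        (hT : (T : Matrix (Fin 3) (Fin 3) ℂ)ᴴ * H.map ι * (T : Matrix (Fin 3) (Fin 3) ℂ) = Literature.Geometry.ComplexHyperbolic.BallModel.J),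
        (∀ τ' : L →+* ℂ, InfinitePlace.mk τ' ≠ InfinitePlace.mk ι → (H.map τ').PosDef) → 2 ≤ Module.finrank ℚ ↥(maximalRealSubfield L) →
        ∀ {n' : ℕ} (e₁ : Fin 3 × Fin 1 ≃ Fin n') (dV : Fin 3 → L) (hdV : ∀ i, IsCMField.complexConj L (dV i) = dV i)
          (hdV0 : ∀ i, dV i ≠ 0) (g : GL (Fin 3) L),
          ((g : Matrix (Fin 3) (Fin 3) L).map (cmConjRingHom L))ᵀ * H * (g : Matrix (Fin 3) (Fin 3) L) = Matrix.diagonal dV →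
          ∀ (ιV : finAdelic (↥(maximalRealSubfield L)) L (IsCMField.complexConj L) 3 H →*
              finAdelic (↥(maximalRealSubfield L)) L (IsCMField.complexConj L) 3 (Matrix.diagonal dV)),
            (∀ k, ((ιV k : finAdelic (↥(maximalRealSubfield L)) L (IsCMField.complexConj L) 3 (Matrix.diagonal dV)) :
                GL (Fin 3) (FiniteAdeleRing (𝓞 L) L)) =
              (toFinAdeleGL L 3 g)⁻¹ * (k : GL (Fin 3) (FiniteAdeleRing (𝓞 L) L)) * toFinAdeleGL L 3 g) →
            ∀ (μ : Measure (adelicGroupData (↥(maximalRealSubfield L)) L (IsCMField.complexConj L) 3 H).automorphicQuotient)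
              [(adelicGroupData (↥(maximalRealSubfield L)) L (IsCMField.complexConj L) 3 H).IsAutomorphicMeasure μ]
              (W : Type) [AddCommGroup W] [Module ℂ W]
              (σ : Representation ℂ (finAdelic (↥(maximalRealSubfield L)) L (IsCMField.complexConj L) 3 H) W),
              σ.IsIrreducible → σ.IsSmooth → σ.IsAdmissible →
              ∀ P : DiscreteAutomorphicRep (adelicGroupData (↥(maximalRealSubfield L)) L (IsCMField.complexConj L) 3 H) μ,
                (P.IsHolCotangentAt (cmArchSection L ι H T hT) (cmCompactFactor L ι H T hT) ∨
                  P.IsAntiholCotangentAt (cmArchSection L ι H T hT) (cmCompactFactor L ι H T hT)) →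
                P.HasFinComponent σ →
                ∃ (μ : Literature.NumberTheory.Automorphic.IdeleClassGroup L →ₜ* Circle) (hμ : IsConjugateSymplectic L μ), HasWeight L μ 1 ∧
                  ∃ (a : (↥(maximalRealSubfield L))ˣ) (χ : Chi (↥(maximalRealSubfield L)) L (IsCMField.complexConj L)),
                    ∀ (v : HeightOneSpectrum (𝓞 ↥(maximalRealSubfield L))) (Tv : Type) [AddCommGroup Tv] [Module ℂ Tv]
                      (τ : Representation ℂ (localPi L (IsCMField.complexConj L) 3 H v) Tv),
                      (τ.IsIrreducible ∧
                        isotypicComponent (MonoidAlgebra ℂ (localPi L (IsCMField.complexConj L) 3 H v))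
                          (Representation.asModule (σ.comp (inclPlace (↥(maximalRealSubfield L)) L (IsCMField.complexConj L) 3 H v)))
                          (Representation.asModule τ) = ⊤) →
                      (τ.IsIrreducible ∧
                        isotypicComponent (MonoidAlgebra ℂ (localPi L (IsCMField.complexConj L) 3 H v))
                          (Representation.asModule
                            ((rhoAtLine (↥(maximalRealSubfield L)) L (IsCMField.complexConj L) 3 e₁ (Matrix.diagonal dV)
                        (complexConj_imagUnit L) (imagUnit_ne_zero L) (imagUnit_mul_self L) (realDiagonal_isSymm L dV hdV)
                        (isUnit_det_realDiagonal L dV hdV hdV0) (realDiagonal_map L dV hdV).symm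
                        (fun a => isCompatible_chiSplittingLine L e₁ dV hdV hdV0 (toHeckeCharacter L μ)
                          (isUnitary_toHeckeCharacter L μ) ((isOscillatorChar_toHeckeCharacter_iff μ).mpr hμ)
                          (TW (↥(maximalRealSubfield L)) a) (isSymm_TW (↥(maximalRealSubfield L)) a)
                          (isUnit_det_TW (↥(maximalRealSubfield L)) a) (JW (↥(maximalRealSubfield L)) L a)
                          (JW_eq (↥(maximalRealSubfield L)) L a)) ιV a χ).comp
                              (inclPlace (↥(maximalRealSubfield L)) L (IsCMField.complexConj L) 3 H v)))
                          (Representation.asModule τ) = ⊤) := by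
  intro L _ _ _ ι H T hT hdef h2 n' e₁ dV hdV hdV0 g hg ιV hιV μA _ W _ _ σ hirr hsm hadm P hP hfin
  obtain ⟨μ, hμ, hw, a, χ, hloc⟩ := hR L ι H T hT hdef h2 e₁ dV hdV hdV0 g hg ιV hιV μA W σ hirr hsm hadm P hP hfin
  refine ⟨μ, hμ, hw, a, χ, fun v Tv _ _ τ hτ => ⟨hτ.1, ?_⟩⟩
  -- CE-L: `ω_H ∘ inclPlace v` is `X_v ∘ κ_v⁻¹`-isotypic and `X_v ∘ κ_v⁻¹` is irreducible (UNCONDITIONAL)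
  obtain ⟨hXirr, hXiso⟩ := F0P2cOmegaLocalType.isLocalTypeAt_rhoAtLine_chi L H e₁ dV hdV hdV0 g hg ιV hιV μ hμ a χ v
  -- two irreducible local types of the non-zero `σ|_v` are equivalent
  haveI : τ.IsIrreducible := hτ.1
  haveI := hXirr
  haveI : Nontrivial W := by
    by_contra hW
    rw [not_nontrivial_iff_subsingleton] at hW
    haveI := hirr
    exact (IsSimpleOrder.bot_ne_top (α := Subrepresentation σ)) (Subrepresentation.toSubmodule_injective (Subsingleton.elim _ _))
  obtain ⟨E⟩ := Literature.RepresentationTheory.Liu2021.nonempty_equiv_of_isotypicComponent_eq_top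
    (inclPlace (↥(maximalRealSubfield L)) L (IsCMField.complexConj L) 3 H v) (Representation.Equiv.refl σ) (hloc v) hτ.2
  -- transport the isotypy of `ω_H ∘ inclPlace v` from `X_v ∘ κ_v⁻¹` to `τ`
  rw [← Literature.RepresentationTheory.isotypicComponent_asModule_congr_type _ _ τ E.toLinearEquiv fun g x => by
    change E.toIntertwiningMap (_) = _
    exact Representation.IntertwiningMap.isIntertwining _ _ E.toIntertwiningMap g x]
  exact hXiso

end Summit.HodgeConjecture.HodgeConjecture.Cruxes.H413.F0P2cStubCEOfLocalThetaTypes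

end
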